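import Summits.QuantumFields.YangMills.Theorems.ColdStartUniversalityLatticeLangevinBakryEmeryHessian
import Summits.QuantumFields.YangMills.Theorems.ColdStartUniversalityLatticeLangevinWilsonExplicitGap
import HarnessLib

/-!
# Route `ColdStartUniversality` (fixed-cut-off package, Bakry–Émery side): the VOLUME-UNIFORM `L²` SPECTRAL GAP `1 − 12|β'|`
# of the `SU(2)` lattice Langevin dynamics and cold-start `L²` mixing at that rate, every torus size `L`, `|β'| < 1/12`

Helper file (seat `ym-line-csu-p1`, g25; `--supports stmt-QuantumFields-24809`).  Plugs the unconditional volume-uniform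
generator-form Poincaré inequality `wilson_generatorPoincare_uniform` (`…BakryEmeryHessian`: `(1 − 12|β'|)·Var ≤ ℰ`) into the
route's `L²`-decay machinery (g16–g19: `integral_sq_transition_sub_le_exp_of_generatorPoincare`, `…_of_measurable`, the cold-start
Jensen/Chapman–Kolmogorov argument of `coldStart_measurable_sq_sub_le_exp_explicit`):
* ★★ `wilson_spectralGap_uniform` — `∫ (κ_t G − μG)² dμ_(β') ≤ e^(−2(1−12|β'|)t) Var_(μ_(β'))(G)`, continuous `G`, every `L`;
* ★ `wilson_spectralGap_uniform_measurable` — the same for bounded measurable `G`;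
* ★ `coldStart_measurable_sq_sub_le_exp_uniform` — cold-start `L²` mixing from a deterministic start after a burn-in, rate `1 − 12|β'|`.
The previous explicit rate `(3/2)e^(−4|β'|#𝒫)` (Holley–Stroock, g19) holds for all `β'` but degenerates with the volume; this one is
volume-independent on the window `|β'| < 1/12` (Shen–Zhu–Zhu, CMP 400 (2023), Cor. 4.4, `SU(2)`, `d = 3`, venture-sharp Hessian).
THEOREMS ONLY, no definition, no sorry.  HONEST FRAMING: fixed cut-off, small `|β'|`; the burn-in constant `D` depends on `L`;
nothing here is uniform in the route's scaling `β'_K → ∞`; no crux, rung or summit statement is proved; the Yang–Mills mass gap is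
NOT proved.
-/

set_option autoImplicit false

noncomputable section

namespace Summit.QuantumFields.YangMills.Theorems.ColdStartUniversality

open MeasureTheory ProbabilityTheory Finset Filter Set Topology
open scoped BigOperators NNReal ENNReal
open Literature.Probability.Process Literature.MathematicalPhysics.QuantumFieldTheory
open Literature.MathematicalPhysics.QuantumLattice (fundamentalRep fundamentalLatticeRep continuous_fundamentalRep)

/-- ★★ **VOLUME-UNIFORM `L²(μ_(β'))` SPECTRAL GAP of the `SU(2)` lattice Langevin dynamics at small `|β'|`, every fixed cut-off.**
For every torus size `L`, every `β'` with `|β'| < 1/12`, every Markov kernel family `κ` realising the SZZ transition laws, every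
continuous `G` and every `t`:  `∫ (κ_t G − μG)² dμ_(β') ≤ exp(−2(1 − 12|β'|)t) · ∫ (G − μG)² dμ_(β')` — the rate does NOT depend on
`L` (Bakry–Émery Poincaré `wilson_generatorPoincare_uniform` + g18's `integral_sq_transition_sub_le_exp_of_generatorPoincare`);
compare `wilson_spectralGap_explicit` (rate `(3/2)e^(−4|β'|#𝒫)`, all `β'`, degenerating with the volume).
[cite: BakryGentilLedoux2014, Thm 4.2.5] [cite: ShenZhuZhu2022, Corollary 4.4] -/
theorem wilson_spectralGap_uniform (L : ℕ) [NeZero L] (β' : ℝ) (hβ : |β'| < 1 / 12)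
    (κ : ℝ≥0 → Kernel (GaugeConfig 3 L (Matrix.specialUnitaryGroup (Fin 2) ℂ))
      (GaugeConfig 3 L (Matrix.specialUnitaryGroup (Fin 2) ℂ))) [∀ t, IsMarkovKernel (κ t)]
    (hreal : ∀ (t : ℝ≥0) (x : GaugeConfig 3 L (Matrix.specialUnitaryGroup (Fin 2) ℂ))
        (Ω : Type) [MeasurableSpace Ω] (P : Measure Ω) [IsProbabilityMeasure P]
        (W : ℝ≥0 → Ω → (Edge 3 L × NoiseIdx 2 → ℝ)) (hW : IsFlatBrownian W P)
        (U : ℝ≥0 → Ω → GaugeConfig 3 L (Matrix.specialUnitaryGroup (Fin 2) ℂ)),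
        (∀ ω, U 0 ω = x) →
        (latticeLangevinDynamics (fundamentalLatticeRep 2) β').IsSolution (fundamentalRep (Fin 2))
          hW.natFiltration P W U →
        κ t x = P.map (U t))
    {G : GaugeConfig 3 L (Matrix.specialUnitaryGroup (Fin 2) ℂ) → ℝ} (hG : Continuous G) (t : ℝ≥0) :
    ∫ x, ((∫ y, G y ∂(κ t x)) - ∫ z, G z ∂(wilsonMeasure (d := 3) (L := L) (fundamentalRep (Fin 2)) β')) ^ 2
        ∂(wilsonMeasure (d := 3) (L := L) (fundamentalRep (Fin 2)) β') ≤
      Real.exp (-2 * (1 - 12 * |β'|) * t) *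
        ∫ x, (G x - ∫ z, G z ∂(wilsonMeasure (d := 3) (L := L) (fundamentalRep (Fin 2)) β')) ^ 2
          ∂(wilsonMeasure (d := 3) (L := L) (fundamentalRep (Fin 2)) β') :=
  integral_sq_transition_sub_le_exp_of_generatorPoincare L β' κ hreal
    (lam := (1 - 12 * |β'|))
    (fun f hf => wilson_generatorPoincare_uniform L β' hβ f hf) hG t

/-- ★ **The volume-uniform spectral gap on bounded measurable observables** (`|β'| < 1/12`): the same decay, rate `1 − 12|β'|`,
for every bounded measurable `G` (g16's bridge `integral_sq_transition_sub_le_exp_of_measurable`); for an event `A`,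
`∫ (κ_t(x,A) − μ(A))² dμ_(β')(x) ≤ e^(−2(1−12|β'|)t) μ(A)(1 − μ(A))`. [cite: RobertsRosenthal1997, Theorem 2.1] -/
theorem wilson_spectralGap_uniform_measurable (L : ℕ) [NeZero L] (β' : ℝ) (hβ : |β'| < 1 / 12)
    (κ : ℝ≥0 → Kernel (GaugeConfig 3 L (Matrix.specialUnitaryGroup (Fin 2) ℂ))
      (GaugeConfig 3 L (Matrix.specialUnitaryGroup (Fin 2) ℂ))) [∀ t, IsMarkovKernel (κ t)]
    (hreal : ∀ (t : ℝ≥0) (x : GaugeConfig 3 L (Matrix.specialUnitaryGroup (Fin 2) ℂ))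
        (Ω : Type) [MeasurableSpace Ω] (P : Measure Ω) [IsProbabilityMeasure P]
        (W : ℝ≥0 → Ω → (Edge 3 L × NoiseIdx 2 → ℝ)) (hW : IsFlatBrownian W P)
        (U : ℝ≥0 → Ω → GaugeConfig 3 L (Matrix.specialUnitaryGroup (Fin 2) ℂ)),
        (∀ ω, U 0 ω = x) →
        (latticeLangevinDynamics (fundamentalLatticeRep 2) β').IsSolution (fundamentalRep (Fin 2))
          hW.natFiltration P W U →
        κ t x = P.map (U t))
    {G : GaugeConfig 3 L (Matrix.specialUnitaryGroup (Fin 2) ℂ) → ℝ} (hG : Measurable G) {M : ℝ} (hM : ∀ x, |G x| ≤ M)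
    (t : ℝ≥0) :
    ∫ x, ((∫ y, G y ∂(κ t x)) - ∫ z, G z ∂(wilsonMeasure (d := 3) (L := L) (fundamentalRep (Fin 2)) β')) ^ 2
        ∂(wilsonMeasure (d := 3) (L := L) (fundamentalRep (Fin 2)) β') ≤
      Real.exp (-2 * (1 - 12 * |β'|) * t) *
        ∫ x, (G x - ∫ z, G z ∂(wilsonMeasure (d := 3) (L := L) (fundamentalRep (Fin 2)) β')) ^ 2
          ∂(wilsonMeasure (d := 3) (L := L) (fundamentalRep (Fin 2)) β') :=
  integral_sq_transition_sub_le_exp_of_measurable L β' κ hreal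
    (fun _ hG' => wilson_spectralGap_uniform L β' hβ κ hreal hG' t) hG hM


/-! ## ★ Cold-start mixing with the volume-uniform rate -/

/-- ★ **Cold-start `L²` mixing of the SZZ dynamics with the VOLUME-UNIFORM rate `1 − 12|β'|`** (`|β'| < 1/12`, fixed cut-off).
For every deterministic start `z` and burn-in `t₁ > 0` there is `D ≥ 0` (density bound of the law at time `t₁` times the Haar/Wilson
comparison constant — this `D` DOES depend on `L` and `β'`) such that for EVERY solution from `z` on ANY filtered probability space:
(i) for every bounded measurable `F` and every `t`, `(∫ F(U_(t₁+t)) dP − μ_(β')F)² ≤ D e^(−2(1−12|β'|)t) Var_(μ_(β'))(F)`;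
(ii) for every measurable `A` and every `t`, `(law(U_(t₁+t))(A) − μ_(β')(A))² ≤ D e^(−2(1−12|β'|)t) μ_(β')(A)(1 − μ_(β')(A))`.
Same proof as `coldStart_measurable_sq_sub_le_exp_explicit` (Chapman–Kolmogorov, Jensen against the dominated law at time `t₁`)
with the uniform gap.  RECORD-rung plumbing at fixed cut-off; nothing K-uniform in the route's scaling.
[cite: RobertsRosenthal1997, Theorem 2.1] [cite: ShenZhuZhu2022, Corollary 4.4] -/
theorem coldStart_measurable_sq_sub_le_exp_uniform (L : ℕ) [NeZero L] (β' : ℝ) (hβ : |β'| < 1 / 12)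
    (z : GaugeConfig 3 L (Matrix.specialUnitaryGroup (Fin 2) ℂ)) (t₁ : ℝ≥0) (ht₁ : 0 < (t₁ : ℝ)) :
    ∃ D : ℝ, 0 ≤ D ∧
      ∀ (Ω : Type) [MeasurableSpace Ω] (P : Measure Ω) [IsProbabilityMeasure P]
        (W : ℝ≥0 → Ω → (Edge 3 L × NoiseIdx 2 → ℝ)) (hW : IsFlatBrownian W P)
        (U : ℝ≥0 → Ω → GaugeConfig 3 L (Matrix.specialUnitaryGroup (Fin 2) ℂ)),
        (∀ ω, U 0 ω = z) →
        (latticeLangevinDynamics (fundamentalLatticeRep 2) β').IsSolution (fundamentalRep (Fin 2))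
          hW.natFiltration P W U →
        (∀ (F : GaugeConfig 3 L (Matrix.specialUnitaryGroup (Fin 2) ℂ) → ℝ), Measurable F →
          ∀ M : ℝ, (∀ x, |F x| ≤ M) → ∀ t : ℝ≥0,
          ((∫ ω, F (U (t₁ + t) ω) ∂P) - ∫ x, F x ∂(wilsonMeasure (d := 3) (L := L) (fundamentalRep (Fin 2)) β')) ^ 2 ≤
            D * Real.exp (-2 * (1 - 12 * |β'|) * t) *
              ∫ x, (F x - ∫ z, F z ∂(wilsonMeasure (d := 3) (L := L) (fundamentalRep (Fin 2)) β')) ^ 2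
                ∂(wilsonMeasure (d := 3) (L := L) (fundamentalRep (Fin 2)) β')) ∧
        (∀ (A : Set (GaugeConfig 3 L (Matrix.specialUnitaryGroup (Fin 2) ℂ))), MeasurableSet A → ∀ t : ℝ≥0,
          ((P.map (U (t₁ + t))).real A - (wilsonMeasure (d := 3) (L := L) (fundamentalRep (Fin 2)) β').real A) ^ 2 ≤
            D * Real.exp (-2 * (1 - 12 * |β'|) * t) *
              ((wilsonMeasure (d := 3) (L := L) (fundamentalRep (Fin 2)) β').real A *
                (1 - (wilsonMeasure (d := 3) (L := L) (fundamentalRep (Fin 2)) β').real A))) := by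
  classical
  haveI := secondCountableTopology_su2
  haveI := borelSpace_config L
  haveI : IsProbabilityMeasure (wilsonMeasure (d := 3) (L := L) (fundamentalRep (Fin 2)) β') :=
    isProbabilityMeasure_wilsonMeasure (d := 3) (L := L) (fundamentalRep (Fin 2)) (continuous_fundamentalRep (Fin 2)) β'
  set c : ℝ := (1 - 12 * |β'|) with hc
  set μ : Measure (GaugeConfig 3 L (Matrix.specialUnitaryGroup (Fin 2) ℂ)) :=
    wilsonMeasure (d := 3) (L := L) (fundamentalRep (Fin 2)) β' with hμ
  -- THE kernels and the density bound at time `t₁`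
  obtain ⟨κ, hκ, -, hreal⟩ := exists_transitionKernel L β'
  haveI := hκ
  obtain ⟨a, ha, -, hπle⟩ := wilsonMeasure_le_smul_pi_haar_and (L := L) β'
  haveI := isProbabilityMeasure_piWiener (Edge 3 L × NoiseIdx 2)
  have hWc := isFlatBrownian_piWiener 3 L (NoiseIdx 2)
  obtain ⟨Uc, hUc0, hUc⟩ := solution_from_start hWc β' z
  obtain ⟨C₁, hC₁, hle₁⟩ := map_le_smul_haar (L := L) β' ht₁ z hWc hUc0 hUc
  have hκle : κ t₁ z ≤ (ENNReal.ofReal (C₁ * a)) • μ := by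
    rw [hreal t₁ z _ _ _ hWc Uc hUc0 hUc, ENNReal.ofReal_mul hC₁, Measure.le_iff]
    intro A hA
    have e1 := Measure.le_iff.1 hle₁ A hA
    have e2 := Measure.le_iff.1 hπle A hA
    simp only [Measure.smul_apply, smul_eq_mul] at e1 e2 ⊢
    calc (Measure.map (Uc t₁) (Measure.pi fun _ : Edge 3 L × NoiseIdx 2 => preWienerMeasure)) A
        ≤ ENNReal.ofReal C₁ * (Measure.pi fun _ : Edge 3 L => haarProbability (Matrix.specialUnitaryGroup (Fin 2) ℂ)) A := e1
      _ ≤ ENNReal.ofReal C₁ * (ENNReal.ofReal a * μ A) := mul_le_mul' le_rfl e2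
      _ = ENNReal.ofReal C₁ * ENNReal.ofReal a * μ A := (mul_assoc _ _ _).symm
  refine ⟨C₁ * a, by positivity, fun Ω _ P _ W hW U hU0 hU => ?_⟩
  -- (i) bounded measurable observables
  have hobs : ∀ (F : GaugeConfig 3 L (Matrix.specialUnitaryGroup (Fin 2) ℂ) → ℝ), Measurable F →
      ∀ M : ℝ, (∀ x, |F x| ≤ M) → ∀ t : ℝ≥0,
      ((∫ ω, F (U (t₁ + t) ω) ∂P) - ∫ x, F x ∂μ) ^ 2 ≤
        C₁ * a * Real.exp (-2 * c * t) * ∫ x, (F x - ∫ z, F z ∂μ) ^ 2 ∂μ := by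
    intro F hF M hM t
    have hFi : ∀ (ν : Measure (GaugeConfig 3 L (Matrix.specialUnitaryGroup (Fin 2) ℂ))) [IsProbabilityMeasure ν],
        Integrable F ν := fun ν _ => integrable_of_abs_le ν hF hM
    have hmU : Measurable (U (t₁ + t)) := (hU.adapted (t₁ + t)).mono (hW.natFiltration.le (t₁ + t)) le_rfl
    have hE : ∫ ω, F (U (t₁ + t) ω) ∂P = ∫ y, (∫ y', F y' ∂(κ t y)) ∂(κ t₁ z) := by
      rw [← integral_map hmU.aemeasurable hF.aestronglyMeasurable, ← hreal (t₁ + t) z Ω P W hW U hU0 hU,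
        chapmanKolmogorov_szz β' κ hreal t₁ t]
      haveI : IsProbabilityMeasure ((κ t ∘ₖ κ t₁) z) := by
        rw [← chapmanKolmogorov_szz β' κ hreal t₁ t]; infer_instance
      exact Kernel.integral_comp (hFi _)
    set m : ℝ := ∫ x, F x ∂μ with hm
    have hκFm : Measurable fun y => ∫ y', F y' ∂(κ t y) := (hF.stronglyMeasurable.integral_kernel (κ := κ t)).measurable
    have hκFb : ∀ y, |(∫ y', F y' ∂(κ t y)) - m| ≤ M + M := fun y =>
      (abs_sub _ _).trans (add_le_add (abs_integral_le_of_abs_le_of_isProbabilityMeasure hM)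
        (abs_integral_le_of_abs_le_of_isProbabilityMeasure hM))
    have hcent : (∫ ω, F (U (t₁ + t) ω) ∂P) - m = ∫ y, ((∫ y', F y' ∂(κ t y)) - m) ∂(κ t₁ z) := by
      rw [hE, integral_sub (integrable_of_abs_le _ hκFm (C := M)
        fun y => abs_integral_le_of_abs_le_of_isProbabilityMeasure hM) (integrable_const m)]
      simp
    rw [hcent]
    have hJ := sq_integral_le_mul_integral_sq_of_measurable (by positivity : (0 : ℝ) ≤ C₁ * a) hκle
      (hκFm.sub measurable_const) hκFb
    have hvar := wilson_spectralGap_uniform_measurable L β' hβ κ hreal hF hM t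
    calc (∫ y, ((∫ y', F y' ∂(κ t y)) - m) ∂(κ t₁ z)) ^ 2
        ≤ (C₁ * a) * ∫ y, ((∫ y', F y' ∂(κ t y)) - m) ^ 2 ∂μ := hJ
      _ ≤ (C₁ * a) * (Real.exp (-2 * c * t) * ∫ x, (F x - m) ^ 2 ∂μ) :=
          mul_le_mul_of_nonneg_left hvar (by positivity)
      _ = C₁ * a * Real.exp (-2 * c * t) * ∫ x, (F x - m) ^ 2 ∂μ := by ring
  refine ⟨hobs, fun A hA t => ?_⟩
  -- (ii) events: `F = 1_A`
  have h1A : ∀ x : GaugeConfig 3 L (Matrix.specialUnitaryGroup (Fin 2) ℂ),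
      |A.indicator (1 : GaugeConfig 3 L (Matrix.specialUnitaryGroup (Fin 2) ℂ) → ℝ) x| ≤ 1 := by
    intro x
    by_cases hx : x ∈ A
    · simp [Set.indicator_of_mem hx]
    · simp [Set.indicator_of_notMem hx]
  have h := hobs (A.indicator (1 : GaugeConfig 3 L (Matrix.specialUnitaryGroup (Fin 2) ℂ) → ℝ))
    (measurable_one.indicator hA) 1 h1A t
  have hmU : Measurable (U (t₁ + t)) := (hU.adapted (t₁ + t)).mono (hW.natFiltration.le (t₁ + t)) le_rfl
  have e1 : ∫ ω, A.indicator (1 : GaugeConfig 3 L (Matrix.specialUnitaryGroup (Fin 2) ℂ) → ℝ) (U (t₁ + t) ω) ∂P =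
      (P.map (U (t₁ + t))).real A := by
    rw [← integral_map hmU.aemeasurable ((measurable_one.indicator hA).aestronglyMeasurable), integral_indicator_one hA]
  rw [e1, integral_indicator_one hA, integral_indicator_sub_sq _ hA] at h
  exact h

end Summit.QuantumFields.YangMills.Theorems.ColdStartUniversality
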